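import Summits.BirchSwinnertonDyer.BirchSwinnertonDyer.Theorems.ClassRecordThreeEulerHalvesAtThreeCartanSupplyPermModel
import HarnessLib

/-!
# SUPPLY from PERMUTATION MODELS, II — the transport done once: a stable pure SUBLATTICE of `ℤ^S` with a basis is a permutation model

Helper file riding `--supports stmt-BirchSwinnertonDyer-19109` (crux `EulerHalvesAtThree`; UNREGISTERED sub-line `Cruxes/EulerHalvesAtThree/Lines/cartan_corr`,
seat `bsd-idea-10` g12), continuing `…CartanSupplyPermModel` (p692372: `CartanPermModelSupply → CartanTorusLatticeSupply`, the mod-3 field automatic).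
There a permutation model still carried an integral representation `ρ` on `ℤ^d` and an equivariant pure embedding `I` — data a per-prime prover would have
to manufacture by a basis transport. HERE that transport is done ONCE: `permAct σ` is the permutation representation of `G = GL₂(𝔽_q)` on `ℤ^n` attached to
`σ : G →* Perm (Fin n)`; a `CartanPermSubmodule q` is a `permAct`-STABLE, PURE sublattice `L ⊂ ℤ^n` (coordinate sums `0`, `Fin n` transitive, `3 ∤ n`) with a
`ℤ`-basis `b : Module.Basis (Fin d) ℤ L`, whose restricted action `resRep` has traces `χ_{W_q}`, plus `η` and the two torus-fixed lines INSIDE `L`;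
`toPermModel` transports it to a `CartanPermModel q` (`ρ g = b.equivFun ∘ (permAct σ g)|_L ∘ b.equivFun⁻¹`, `I = L.subtype ∘ b.equivFun⁻¹`), and
`cartanTorusLatticeSupply_of_permSubmoduleSupply : CartanPermSubmoduleSupply → CartanTorusLatticeSupply` (SUPPLY, the v11 stub of 23422's line
`cartan`, BY NAME). So a prover closing SUPPLY at a prime `q` now exhibits only: the `G`-set (`σ`), the sublattice `L` (e.g. the kernel of
`d·Σ_g χ_W(g)·permAct σ g − #G`, automatically pure and stable), a basis (`Submodule.basisOfPid` or explicit), the trace identity, `η`, and two vectors.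
HONEST FRAMING: transport lemmas only; SUPPLY ∕ NUM ∕ (F2b♭) ∕ the cruxes are NOT proved; BSD is proved for no curve. [folklore]
-/

set_option linter.dupNamespace false
set_option autoImplicit false

namespace Summit.BirchSwinnertonDyer.BirchSwinnertonDyer.Theorems.CartanSupply

open Summit.BirchSwinnertonDyer.BirchSwinnertonDyer.Theorems.CartanDegree
open Summit.BirchSwinnertonDyer.BirchSwinnertonDyer.Theorems.CartanCorrespondence

/-! ## §1 The permutation representation of `ℤ^n` attached to `σ : G →* Perm (Fin n)` -/

/-- `(permAct σ g φ) i = φ ((σ g)⁻¹ i)`. -/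
def permAct {G : Type*} [Group G] {n : ℕ} (σ : G →* Equiv.Perm (Fin n)) : Representation ℤ G (Fin n → ℤ) where
  toFun g :=
    { toFun := fun φ i => φ ((σ g)⁻¹ i)
      map_add' := by intro φ ψ; rfl
      map_smul' := by intro c φ; rfl }
  map_one' := by
    apply LinearMap.ext; intro φ; funext i
    simp only [map_one, inv_one, Equiv.Perm.coe_one, id_eq, LinearMap.coe_mk, AddHom.coe_mk, Module.End.one_apply]
  map_mul' := by
    intro g h; apply LinearMap.ext; intro φ; funext i
    simp only [map_mul, mul_inv_rev, Equiv.Perm.coe_mul, Function.comp_apply, LinearMap.coe_mk, AddHom.coe_mk,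
      Module.End.mul_apply]

/-- PROVED: `(g·φ)(g i) = φ(i)`. [folklore] -/
theorem permAct_apply_perm {G : Type*} [Group G] {n : ℕ} (σ : G →* Equiv.Perm (Fin n)) (g : G) (φ : Fin n → ℤ) (i : Fin n) :
    permAct σ g φ (σ g i) = φ i := by
  show φ ((σ g)⁻¹ (σ g i)) = φ i
  simp only [Equiv.Perm.coe_inv, Equiv.symm_apply_apply]

/-! ## §2 The datum: a stable pure sublattice with a basis, traces, `η`, torus lines -/

/-- A PERMUTATION SUBMODULE MODEL of the Cartan torus lattice at `q`. -/
structure CartanPermSubmodule (q : ℕ) where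
  /-- size of the `G`-set. -/
  n : ℕ
  /-- the permutation action of `GL₂(𝔽_q)` on `Fin n`. -/
  σ : GL (Fin 2) (ZMod q) →* Equiv.Perm (Fin n)
  σ_trans : ∀ i j : Fin n, ∃ g, σ g i = j
  three_not_dvd : ¬ 3 ∣ n
  /-- the sublattice `L ⊂ ℤ^n`. -/
  L : Submodule ℤ (Fin n → ℤ)
  L_stab : ∀ g, ∀ φ ∈ L, permAct σ g φ ∈ L
  L_pure : ∀ φ : Fin n → ℤ, (3 : ℤ) • φ ∈ L → φ ∈ L
  L_sum : ∀ φ ∈ L, ∑ i, φ i = 0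
  /-- rank and basis. -/
  d : ℕ
  b : Module.Basis (Fin d) ℤ L
  /-- traces of the restricted action `= χ_{W_q}`. -/
  trace_eq : ∀ g, LinearMap.trace ℤ L ((permAct σ g).restrict (L_stab g)) = cubicNewvectorChar q g
  /-- the non-split torus `𝔽_q[η]^×`. -/
  η : Matrix (Fin 2) (Fin 2) (ZMod q)
  η_irred : ¬ HasRatEigenvalue η
  /-- generators of the split- ∕ non-split-torus-fixed lines of `L`. -/
  φS : Fin n → ℤ
  φC : Fin n → ℤ
  φS_mem : φS ∈ L
  φC_mem : φC ∈ L
  φS_fixed : ∀ g : GL (Fin 2) (ZMod q), (g : Matrix (Fin 2) (Fin 2) (ZMod q)) 0 1 = 0 →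
    (g : Matrix (Fin 2) (Fin 2) (ZMod q)) 1 0 = 0 → permAct σ g φS = φS
  φC_fixed : ∀ g : GL (Fin 2) (ZMod q), (g : Matrix (Fin 2) (Fin 2) (ZMod q)) * η = η * g → permAct σ g φC = φC
  φS_gen : ∀ φ ∈ L, (∀ g : GL (Fin 2) (ZMod q), (g : Matrix (Fin 2) (Fin 2) (ZMod q)) 0 1 = 0 →
    (g : Matrix (Fin 2) (Fin 2) (ZMod q)) 1 0 = 0 → permAct σ g φ = φ) → ∃ m : ℤ, φ = m • φS
  φC_gen : ∀ φ ∈ L, (∀ g : GL (Fin 2) (ZMod q), (g : Matrix (Fin 2) (Fin 2) (ZMod q)) * η = η * g → permAct σ g φ = φ) →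
    ∃ m : ℤ, φ = m • φC
  φS_ne : φS ≠ 0
  φC_ne : φC ≠ 0

/-- **PERMUTATION-SUBMODULE SUPPLY**: every prime `q ≠ 3` carries a permutation submodule model. [folklore] -/
@[conjecture]
def CartanPermSubmoduleSupply : Prop := ∀ q : ℕ, q.Prime → q ≠ 3 → Nonempty (CartanPermSubmodule q)

variable {q : ℕ}

/-! ## §3 The restricted and the transported representation -/

/-- The action restricted to `L`. -/
def resRep (M : CartanPermSubmodule q) : Representation ℤ (GL (Fin 2) (ZMod q)) M.L where
  toFun g := (permAct M.σ g).restrict (M.L_stab g)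
  map_one' := by
    apply LinearMap.ext; intro x; apply Subtype.ext
    simp only [LinearMap.coe_restrict_apply, map_one, Module.End.one_apply]
  map_mul' := by
    intro g h; apply LinearMap.ext; intro x; apply Subtype.ext
    simp only [LinearMap.coe_restrict_apply, map_mul, Module.End.mul_apply]

/-- PROVED: unfolding. [folklore] -/
theorem coe_resRep_apply (M : CartanPermSubmodule q) (g : GL (Fin 2) (ZMod q)) (x : M.L) :
    ((resRep M g x : M.L) : Fin M.n → ℤ) = permAct M.σ g (x : Fin M.n → ℤ) := rfl

/-- The action transported to `ℤ^d` along the basis. -/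
noncomputable def transRep (M : CartanPermSubmodule q) : Representation ℤ (GL (Fin 2) (ZMod q)) (Fin M.d → ℤ) where
  toFun g := M.b.equivFun.conj (resRep M g)
  map_one' := by rw [map_one, Module.End.one_eq_id, LinearEquiv.conj_id]; rfl
  map_mul' := by intro g h; rw [map_mul, Module.End.mul_eq_comp, LinearEquiv.conj_comp]; rfl

/-- PROVED: unfolding. [folklore] -/
theorem transRep_apply (M : CartanPermSubmodule q) (g : GL (Fin 2) (ZMod q)) (v : Fin M.d → ℤ) :
    transRep M g v = M.b.equivFun (resRep M g (M.b.equivFun.symm v)) := rfl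

/-- PROVED: traces are preserved by the transport. [folklore] -/
theorem trace_transRep (M : CartanPermSubmodule q) (g : GL (Fin 2) (ZMod q)) :
    LinearMap.trace ℤ (Fin M.d → ℤ) (transRep M g) = cubicNewvectorChar q g := by
  rw [← M.trace_eq g]
  exact LinearMap.trace_conj' _ _

/-- The embedding `I = L.subtype ∘ b.equivFun⁻¹ : ℤ^d → ℤ^n`. -/
noncomputable def embed (M : CartanPermSubmodule q) : (Fin M.d → ℤ) →ₗ[ℤ] (Fin M.n → ℤ) :=
  M.L.subtype ∘ₗ (M.b.equivFun.symm : (Fin M.d → ℤ) →ₗ[ℤ] M.L)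

/-- PROVED: unfolding. [folklore] -/
theorem embed_apply (M : CartanPermSubmodule q) (v : Fin M.d → ℤ) :
    embed M v = ((M.b.equivFun.symm v : M.L) : Fin M.n → ℤ) := rfl

/-- PROVED: `I` is injective. [folklore] -/
theorem embed_injective (M : CartanPermSubmodule q) : Function.Injective (embed M) :=
  fun v w h => M.b.equivFun.symm.injective (Subtype.ext (by rw [← embed_apply, ← embed_apply, h]))

/-- PROVED: equivariance `I (ρ g v) (σ g i) = I v i`. [folklore] -/
theorem embed_equiv (M : CartanPermSubmodule q) (g : GL (Fin 2) (ZMod q)) (v : Fin M.d → ℤ) (i : Fin M.n) :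
    embed M (transRep M g v) (M.σ g i) = embed M v i := by
  rw [embed_apply, transRep_apply, LinearEquiv.symm_apply_apply, coe_resRep_apply, permAct_apply_perm, embed_apply]

/-- PROVED: purity `I v ∈ 3ℤ^n ⇒ v ∈ 3ℤ^d`. [folklore] -/
theorem embed_pure (M : CartanPermSubmodule q) (v : Fin M.d → ℤ) (w : Fin M.n → ℤ) (h : embed M v = (3 : ℤ) • w) :
    ∃ u : Fin M.d → ℤ, v = (3 : ℤ) • u := by
  have hw : (3 : ℤ) • w ∈ M.L := by rw [← h, embed_apply]; exact (M.b.equivFun.symm v).2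
  have hwL : w ∈ M.L := M.L_pure w hw
  refine ⟨M.b.equivFun ⟨w, hwL⟩, ?_⟩
  have hx : M.b.equivFun.symm v = (3 : ℤ) • (⟨w, hwL⟩ : M.L) := by
    apply Subtype.ext
    rw [← embed_apply, h, Submodule.coe_smul]
  rw [← map_smul, ← hx, LinearEquiv.apply_symm_apply]

/-- PROVED: coordinate sums vanish on the image. [folklore] -/
theorem embed_sum (M : CartanPermSubmodule q) (v : Fin M.d → ℤ) : ∑ i, embed M v i = 0 := by
  rw [embed_apply]
  exact M.L_sum _ (M.b.equivFun.symm v).2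

/-! ## §4 The torus lines transported -/

/-- PROVED: `ρ g (b.equivFun x) = b.equivFun x ⟺ permAct σ g x = x` (one direction each). [folklore] -/
theorem transRep_equivFun_eq (M : CartanPermSubmodule q) (g : GL (Fin 2) (ZMod q)) (x : M.L)
    (h : permAct M.σ g (x : Fin M.n → ℤ) = x) : transRep M g (M.b.equivFun x) = M.b.equivFun x := by
  rw [transRep_apply, LinearEquiv.symm_apply_apply]
  congr 1
  exact Subtype.ext (by rw [coe_resRep_apply, h])

/-- PROVED: conversely. [folklore] -/
theorem permAct_eq_of_transRep_eq (M : CartanPermSubmodule q) (g : GL (Fin 2) (ZMod q)) (v : Fin M.d → ℤ)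
    (h : transRep M g v = v) : permAct M.σ g (embed M v) = embed M v := by
  rw [transRep_apply] at h
  have h2 : resRep M g (M.b.equivFun.symm v) = M.b.equivFun.symm v := by
    apply M.b.equivFun.injective
    rw [h, LinearEquiv.apply_symm_apply]
  rw [embed_apply, ← coe_resRep_apply, h2]

/-- PROVED: a line generator in `L` transports to a line generator in `ℤ^d`. [folklore] -/
theorem eq_smul_equivFun_of_eq_smul (M : CartanPermSubmodule q) (v : Fin M.d → ℤ) (φ : Fin M.n → ℤ) (hφ : φ ∈ M.L) (m : ℤ)
    (h : embed M v = m • φ) : v = m • M.b.equivFun ⟨φ, hφ⟩ := by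
  have hx : M.b.equivFun.symm v = m • (⟨φ, hφ⟩ : M.L) := by
    apply Subtype.ext
    rw [← embed_apply, h, Submodule.coe_smul]
  rw [← map_smul, ← hx, LinearEquiv.apply_symm_apply]

/-- PROVED: the transported split-torus line is fixed. [folklore] -/
theorem wS_transport_fixed (M : CartanPermSubmodule q) : ∀ g : GL (Fin 2) (ZMod q), (g : Matrix (Fin 2) (Fin 2) (ZMod q)) 0 1 = 0 →
    (g : Matrix (Fin 2) (Fin 2) (ZMod q)) 1 0 = 0 → transRep M g (M.b.equivFun ⟨M.φS, M.φS_mem⟩) = M.b.equivFun ⟨M.φS, M.φS_mem⟩ :=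
  fun g h01 h10 => transRep_equivFun_eq M g _ (M.φS_fixed g h01 h10)

/-- PROVED: the transported non-split-torus line is fixed. [folklore] -/
theorem wC_transport_fixed (M : CartanPermSubmodule q) : ∀ g : GL (Fin 2) (ZMod q), (g : Matrix (Fin 2) (Fin 2) (ZMod q)) * M.η = M.η * g →
    transRep M g (M.b.equivFun ⟨M.φC, M.φC_mem⟩) = M.b.equivFun ⟨M.φC, M.φC_mem⟩ :=
  fun g hg => transRep_equivFun_eq M g _ (M.φC_fixed g hg)

/-- PROVED: the transported split-torus line generates the fixed sublattice. [folklore] -/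
theorem wS_transport_gen (M : CartanPermSubmodule q) : ∀ v : Fin M.d → ℤ, (∀ g : GL (Fin 2) (ZMod q), (g : Matrix (Fin 2) (Fin 2) (ZMod q)) 0 1 = 0 →
    (g : Matrix (Fin 2) (Fin 2) (ZMod q)) 1 0 = 0 → transRep M g v = v) → ∃ m : ℤ, v = m • M.b.equivFun ⟨M.φS, M.φS_mem⟩ := by
  intro v hv
  obtain ⟨m, hm⟩ := M.φS_gen (embed M v) (by rw [embed_apply]; exact (M.b.equivFun.symm v).2)
    (fun g h01 h10 => permAct_eq_of_transRep_eq M g v (hv g h01 h10))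
  exact ⟨m, eq_smul_equivFun_of_eq_smul M v M.φS M.φS_mem m hm⟩

/-- PROVED: the transported non-split-torus line generates the fixed sublattice. [folklore] -/
theorem wC_transport_gen (M : CartanPermSubmodule q) : ∀ v : Fin M.d → ℤ, (∀ g : GL (Fin 2) (ZMod q), (g : Matrix (Fin 2) (Fin 2) (ZMod q)) * M.η = M.η * g →
    transRep M g v = v) → ∃ m : ℤ, v = m • M.b.equivFun ⟨M.φC, M.φC_mem⟩ := by
  intro v hv
  obtain ⟨m, hm⟩ := M.φC_gen (embed M v) (by rw [embed_apply]; exact (M.b.equivFun.symm v).2)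
    (fun g hg => permAct_eq_of_transRep_eq M g v (hv g hg))
  exact ⟨m, eq_smul_equivFun_of_eq_smul M v M.φC M.φC_mem m hm⟩

/-- PROVED: the transported split-torus line is non-zero. [folklore] -/
theorem wS_transport_ne (M : CartanPermSubmodule q) : M.b.equivFun ⟨M.φS, M.φS_mem⟩ ≠ 0 :=
  fun h => M.φS_ne (congrArg Subtype.val ((LinearEquiv.map_eq_zero_iff M.b.equivFun).mp h))

/-- PROVED: the transported non-split-torus line is non-zero. [folklore] -/
theorem wC_transport_ne (M : CartanPermSubmodule q) : M.b.equivFun ⟨M.φC, M.φC_mem⟩ ≠ 0 :=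
  fun h => M.φC_ne (congrArg Subtype.val ((LinearEquiv.map_eq_zero_iff M.b.equivFun).mp h))

/-! ## §5 The permutation model of a permutation submodule model; SUPPLY by name -/

/-- The transport `CartanPermSubmodule q → CartanPermModel q`. -/
noncomputable def toPermModel (M : CartanPermSubmodule q) : CartanPermModel q where
  d := M.d
  ρ := transRep M
  trace_eq := trace_transRep M
  n := M.n
  σ := M.σ
  σ_trans := M.σ_trans
  three_not_dvd := M.three_not_dvd
  I := embed M
  I_inj := embed_injective M
  I_equiv := embed_equiv M
  I_pure := embed_pure M
  I_sum := embed_sum M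
  η := M.η
  η_irred := M.η_irred
  wS := M.b.equivFun ⟨M.φS, M.φS_mem⟩
  wC := M.b.equivFun ⟨M.φC, M.φC_mem⟩
  wS_fixed := wS_transport_fixed M
  wC_fixed := wC_transport_fixed M
  wS_gen := wS_transport_gen M
  wC_gen := wC_transport_gen M
  wS_ne := wS_transport_ne M
  wC_ne := wC_transport_ne M

/-- PROVED — one prime at a time: a permutation submodule model at `q` gives the `q`-instance of SUPPLY. [folklore] -/
theorem cartanTorusLatticeSupplyAt_of_permSubmodule (M : CartanPermSubmodule q) :
    ∃ (𝓛 : CartanTorusLattice q) (wS wC : Fin 𝓛.d → ℤ),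
      𝓛.IsSplitFixed wS ∧ 𝓛.IsNonsplitFixed wC ∧
      (∀ v, 𝓛.IsSplitFixed v → ∃ m : ℤ, v = m • wS) ∧ (∀ v, 𝓛.IsNonsplitFixed v → ∃ m : ℤ, v = m • wC) ∧ wS ≠ 0 ∧ wC ≠ 0 :=
  cartanTorusLatticeSupplyAt_of_permModel (toPermModel M)

/-- PROVED — `CartanPermSubmoduleSupply → CartanPermModelSupply`. [folklore] -/
theorem cartanPermModelSupply_of_permSubmoduleSupply (h : CartanPermSubmoduleSupply) : CartanPermModelSupply :=
  fun q hq h3 => (h q hq h3).elim fun M => ⟨toPermModel M⟩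

/-- PROVED — **SUPPLY ⟸ PERMUTATION-SUBMODULE SUPPLY** (`CartanTorusLatticeSupply` BY NAME). [folklore] -/
theorem cartanTorusLatticeSupply_of_permSubmoduleSupply (h : CartanPermSubmoduleSupply) : CartanTorusLatticeSupply :=
  fun q hq h3 => (h q hq h3).elim fun M => cartanTorusLatticeSupplyAt_of_permSubmodule M

end Summit.BirchSwinnertonDyer.BirchSwinnertonDyer.Theorems.CartanSupply
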